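import Summits.QuantumFields.YangMills.Theorems.BalabanUVNodesK0RecordFormatNamesLemmas8
import Summits.QuantumFields.YangMills.Theorems.BalabanUVNodesPortS1Spaces

/-!
# NODE O port PT-A — THE NORMALISATION SUBTRACTION OF (2.12)∕(2.14) IN THE RESIDUE's CURRENCY: «value at `U_{k+1}(W_B)` MINUS value at `1`»
# If an object `Ψ` represents the UN-subtracted functional `G` (`log Z^{(k)}(U_{k+1}(W_B))`, resp. `𝐄^{(k+1)}(g_k, U_{k+1}(W_B))`) with rows (a)(b), then the formula
# `Ψ⁻(X̂, f) := Ψ(X̂, f) − Ψ(X̂, 𝟙)` (subtract the value at the unit pair `𝟙 = (1, 0)`) represents `B ↦ G(B) − G(0)` — print's brackets `[log Z^{(k)}(U) − log Z^{(k)}(1)]` and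
# `𝐄^{(k+1)}(U) − log 𝐍″_k` ((2.14): «the normalization constant 𝐍″_k is equal to the integral above at U_{k+1} = 1») — with rows (LOC)(GI)(a) and (b) at constant `2E₀`

Cell `ym-nodeO-ideate`, porter seat `ymgap-nodeO-port-PTA-1` (gen 3); `--supports stmt-QuantumFields-27930` (helper).  [I] = [Balaban1987RG1], [II] = [Balaban1988RG2Cluster].
Vocabulary: DEF-1 edition 13 ∕ lemma file 8; gen 0–2's `…PortS1Spaces` (`encodeCfg_unitPair_mem_recordUc`, `embedPair_unitPair`, `recordCurrent_zero`), `…PortS1Selector` (`recordBgField_zero`,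
`succ_le_m_add_K_recordK₀`).

WHY.  The SPLIT consumed by `…PortS1ResidueIntLocal.sig27930v8LR4_of_intLocalFormula₂` has `Φ₁ n B = log Z^{(k)}_rec(U_B) − log Z^{(k)}_rec(1)` and `Φ₂ n B = newTerm(U_B) − newTerm(1)` ([I] (2.12) p.268,
S2A-SPEC-v1 §1): DIFFERENCES.  The expansions ([16] (63), [II] (2.13)) represent the UN-subtracted functionals.  This file is the passage, once: (f′) at `B = 0` is an honest equation
(`𝓝 0 ∋ 0`: `Filter.Eventually.self_of_nhds`), the (f′) integrand at `B = 0` IS the unit pair (`pairCutAt … X 0 = 𝟙`: `U_{k+1}(W_0) = 1` in the rooted gauge and `J(1) = 0`), and the unit pair lies in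
every record space (positive radii), so (b) doubles the constant and nothing else moves.
* §1 `pullPair_unitPair`, ★ `pairCutAt_zero`.
* §2 rows for `Ψ⁻`: `isLocal_subUnit`, `isGaugeInv_subUnit`, `analyticOnUc_subUnit`, `bound118OnUc_subUnit` (`2·E₀`), ★ `represents_subUnit` (`G − G(0)`).
* §3 ★★ `exists_residueAt_subUnit` — from ONE object with `ResidueAt … E₀ κ G`: an object with `ResidueAt … (2·E₀) κ (fun n B => G n B − G n 0)` (the term is built in the proof by the anonymous
  constructor — no `def`).

HONEST FRAMING.  Bookkeeping; NO expansion of Bałaban's is constructed, the residue is NOT proved; 27930 OPEN; K0⁷ NOT closed; NODE O 0∕1; COUNT 8∕28 · K 1∕4 UNMOVED; finite `𝕋⁴_{L^K}` at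
fixed ε — NOT continuum ∕ OS ∕ Clay; **the Yang–Mills mass gap is NOT proved by any of this.**  No `sorry`, no `def`, no `instance`; standard axioms.
-/

noncomputable section

open scoped BigOperators Matrix.Norms.L2Operator Topology

namespace Summit.QuantumFields.YangMills.Theorems.BalabanUVNodesPortS1

open Summit.QuantumFields.YangMills.Theorems.K0RecordFormatNames
open Literature.MathematicalPhysics.QuantumFieldTheory.Balaban1983to89
open Literature.MathematicalPhysics.QuantumFieldTheory.Balaban1983to89.Node00
open Literature.MathematicalPhysics.QuantumFieldTheory.Balaban1983to89.T4Continuum (T4Family)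
open _root_.Filter

variable (F : T4Family)

/-! ## §1  The unit pair on integer bonds; the (f′) integrand at `B = 0` -/

/-- The pull-back of the unit pair `(1, 0)` is the constant integer-bond configuration `𝟙 = (1, 0)`. [cite: Balaban1987RG1, (1.9) p.262 (bookkeeping)] -/
theorem pullPair_unitPair (K : ℕ) :
    pullPair F K (Sect2.embedPair (B12RegularSpaces111Mono.unitPair : FieldPair (F.P K) 0 (MatA 2)ˣ (MatA 2))) =
      fun _ => ((1 : MatA 2), (0 : MatA 2)) := by
  rw [embedPair_unitPair]
  rfl

/-- ★ **The (f′) integrand AT `B = 0` is the unit configuration**: `pairCutAt … X 0 = 𝟙` — `U_{k+1}(W_0) = 1` in the rooted gauge (`recordBgField_zero`), `J_{k+1}(W_0) = 0`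
(`recordCurrent_zero`), and the cut is `1 ∕ 0` off `X` anyway. [cite: Balaban1987RG1, (2.3) p.265, (1.8)–(1.9) p.261, (2.14) p.268] -/
theorem pairCutAt_zero (a₀ ε₂₉ : ℝ) (Mc k n : ℕ) (X : (recordDomSys F Mc k (recordK₀ F Mc k + n)).Dom) :
    letI θ := thetaFill F a₀ ε₂₉; letI := θ.instVβ₁; letI := θ.instVβ₂; letI := θ.instιβ
    pairCutAt F a₀ ε₂₉ Mc k (recordK₀ F Mc k + n) X (0 : recordW F a₀ ε₂₉ k (recordK₀ F Mc k + n)) =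
      fun _ => ((1 : MatA 2), (0 : MatA 2)) := by
  have hk := succ_le_m_add_K_recordK₀ F Mc k n
  -- the (f′) integrand is the pull-back of the decoded chart origin (the cut pair of `(U_{k+1}(W_0), J(U_{k+1}(W_0)))`), `rfl` after the decoding lemma
  have step : (letI θ := thetaFill F a₀ ε₂₉; letI := θ.instVβ₁; letI := θ.instVβ₂; letI := θ.instιβ
      pairCutAt F a₀ ε₂₉ Mc k (recordK₀ F Mc k + n) X (0 : recordW F a₀ ε₂₉ k (recordK₀ F Mc k + n))) =
      (letI θ := thetaFill F a₀ ε₂₉; letI := θ.instVβ₁; letI := θ.instVβ₂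
       pullPair F (recordK₀ F Mc k + n)
        (decodeCfg F (recordK₀ F Mc k + n) (recordChartJ F Mc k (recordK₀ F Mc k + n) X (recordEmbJ F θ k (recordK₀ F Mc k + n) 0)))) := by
    rw [decodeCfg_recordChartJ_recordEmbJ_zero F (thetaFill F a₀ ε₂₉) Mc hk X]
    rfl
  rw [step, decodeCfg_recordChartJ_recordEmbJ_zero_eq_unitPair F (thetaFill F a₀ ε₂₉) Mc hk X]
  rfl

/-! ## §2  Rows for the unit-subtracted formula `Ψ⁻(X̂, f) := Ψ(X̂, f) − Ψ(X̂, 𝟙)` -/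

/-- (LOC) for `Ψ⁻`. [cite: Balaban1987RG1, (1.7) p.261 (bookkeeping)] -/
theorem isLocal_subUnit (s : ℕ) (Ψ : IntFormula) (h : Ψ.IsLocal s) :
    IntFormula.IsLocal s (fun Xh f => Ψ Xh f - Ψ Xh (fun _ => ((1 : MatA 2), (0 : MatA 2)))) := by
  intro Xh f f' hf
  show Ψ Xh f - _ = Ψ Xh f' - _
  rw [h Xh f f' hf]

/-- (GI) for `Ψ⁻` (the subtracted constant does not see `f`). [cite: Balaban1987RG1, (1.19) p.263 (bookkeeping)] -/
theorem isGaugeInv_subUnit (Ψ : IntFormula) (h : Ψ.IsGaugeInv) :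
    IntFormula.IsGaugeInv (fun Xh f => Ψ Xh f - Ψ Xh (fun _ => ((1 : MatA 2), (0 : MatA 2)))) := by
  intro Xh û hû f
  show Ψ Xh _ - _ = Ψ Xh f - _
  rw [h Xh û hû f]

/-- The piece of `Ψ⁻` is the piece of `Ψ` minus the piece of `Ψ` at the unit pair. [cite: Balaban1987RG1, (1.7) p.261 (bookkeeping)] -/
theorem piece_subUnit (Ψ : IntFormula) (Mc k K : ℕ) (X : (recordDomSys F Mc k K).Dom) (φ : Sect2.CPair (F.P K) (MatA 2)) :
    IntFormula.piece F (fun Xh f => Ψ Xh f - Ψ Xh (fun _ => ((1 : MatA 2), (0 : MatA 2)))) Mc k K X φ =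
      Ψ.piece F Mc k K X φ - Ψ.piece F Mc k K X (Sect2.embedPair (B12RegularSpaces111Mono.unitPair : FieldPair (F.P K) 0 (MatA 2)ˣ (MatA 2))) := by
  rw [IntFormula.piece_eq, IntFormula.piece_eq, IntFormula.piece_eq, embedPair_unitPair]

/-- (a) for `Ψ⁻`. [cite: Balaban1987RG1, p.263 («analytic on the space U^c_j»; bookkeeping)] -/
theorem analyticOnUc_subUnit (Ψ : IntFormula) (Mc k : ℕ) (α₀ α₁ : ℝ) (h : Ψ.AnalyticOnUc F Mc k α₀ α₁) :
    IntFormula.AnalyticOnUc F (fun Xh f => Ψ Xh f - Ψ Xh (fun _ => ((1 : MatA 2), (0 : MatA 2)))) Mc k α₀ α₁ := by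
  rw [IntFormula.analyticOnUc_iff] at h ⊢
  intro n X φ hφ
  have hfun : (fun ψ => IntFormula.piece F (fun Xh f => Ψ Xh f - Ψ Xh (fun _ => ((1 : MatA 2), (0 : MatA 2)))) Mc k (recordK₀ F Mc k + n) X ψ) =
      fun ψ => Ψ.piece F Mc k (recordK₀ F Mc k + n) X ψ -
        Ψ.piece F Mc k (recordK₀ F Mc k + n) X (Sect2.embedPair (B12RegularSpaces111Mono.unitPair : FieldPair (F.P _) 0 (MatA 2)ˣ (MatA 2))) :=
    funext fun ψ => piece_subUnit F Ψ Mc k _ X ψ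
  rw [hfun]
  exact (h n X φ hφ).sub analyticAt_const

/-- (b) for `Ψ⁻` at constant `2·E₀` (the unit pair lies in every record space: positive radii). [cite: Balaban1987RG1, (1.18) p.263, p.263 L5–13] -/
theorem bound118OnUc_subUnit (Ψ : IntFormula) (Mc k : ℕ) {α₀ α₁ : ℝ} (h₀ : 0 < α₀) (h₁ : 0 < α₁) (E₀ κ : ℝ) (h : Ψ.Bound118OnUc F Mc k α₀ α₁ E₀ κ) :
    IntFormula.Bound118OnUc F (fun Xh f => Ψ Xh f - Ψ Xh (fun _ => ((1 : MatA 2), (0 : MatA 2)))) Mc k α₀ α₁ (2 * E₀) κ := by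
  rw [IntFormula.bound118OnUc_iff] at h ⊢
  intro n X φ hφ
  rw [piece_subUnit, two_mul, add_mul]
  exact (norm_sub_le _ _).trans (add_le_add (h n X φ hφ) (h n X _ (encodeCfg_unitPair_mem_recordUc F Mc k _ X h₀ h₁)))

/-- ★ **(f′) for `Ψ⁻`**: if `Ψ` represents `G` near `B = 0`, then `Ψ⁻` represents `B ↦ G(B) − G(0)` — the germ identity holds AT `0` (`self_of_nhds`) where the integrand is `𝟙`
(`pairCutAt_zero`). [cite: Balaban1987RG1, (2.12)–(2.14) p.268, (1.6)–(1.9) p.261] -/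
theorem represents_subUnit (Ψ : IntFormula) (a₀ ε₂₉ : ℝ) (Mc k : ℕ) (G : (n : ℕ) → recordW F a₀ ε₂₉ k (recordK₀ F Mc k + n) → ℂ)
    (h : Ψ.Represents F a₀ ε₂₉ Mc k G) :
    IntFormula.Represents F (fun Xh f => Ψ Xh f - Ψ Xh (fun _ => ((1 : MatA 2), (0 : MatA 2)))) a₀ ε₂₉ Mc k
      (fun n B => G n B - G n (letI θ := thetaFill F a₀ ε₂₉; letI := θ.instVβ₁; letI := θ.instVβ₂; 0)) := by
  rw [IntFormula.represents_iff] at h ⊢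
  intro n
  letI θ := thetaFill F a₀ ε₂₉; letI := θ.instVβ₁; letI := θ.instVβ₂; letI := θ.instιβ
  have h0 := (h n).self_of_nhds
  have hz := pairCutAt_zero F a₀ ε₂₉ Mc k n
  simp only [hz] at h0
  filter_upwards [h n] with B hB
  rw [hB, h0, ← Finset.sum_sub_distrib]

/-! ## §3  ★★ From one object representing `G`: an object representing `G − G(0)` with `2·E₀` -/

/-- ★★ **THE NORMALISATION SUBTRACTION AT THE OBJECT LEVEL**: an `IntLocalFormula (L^{k+1}·Mc)` with `ResidueAt … E₀ κ G` (positive radii) yields an `IntLocalFormula (L^{k+1}·Mc)` with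
`ResidueAt … (2·E₀) κ (fun n B => G n B − G n 0)` — what `sig27930v8LR4_of_intLocalFormula₂` consumes for `Φ₁ = log Z^{(k)}(U_B) − log Z^{(k)}(1)` and `Φ₂ = 𝐄^{(k+1)}(U_B) − log 𝐍″_k` once the
UN-subtracted functionals are represented. [cite: Balaban1987RG1, (2.12)–(2.14) p.268, (1.18) p.263; Balaban1988RG2Cluster, p.21] -/
theorem exists_residueAt_subUnit (Mc k : ℕ) (Ψ : IntLocalFormula (F.L ^ (k + 1) * Mc)) (a₀ ε₂₉ : ℝ) {α₀ α₁ : ℝ} (h₀ : 0 < α₀) (h₁ : 0 < α₁) (E₀ κ : ℝ)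
    (G : (n : ℕ) → recordW F a₀ ε₂₉ k (recordK₀ F Mc k + n) → ℂ) (h : Ψ.ResidueAt F Mc k a₀ ε₂₉ α₀ α₁ E₀ κ G) :
    ∃ Ψ' : IntLocalFormula (F.L ^ (k + 1) * Mc),
      Ψ'.ResidueAt F Mc k a₀ ε₂₉ α₀ α₁ (2 * E₀) κ (fun n B => G n B - G n (letI θ := thetaFill F a₀ ε₂₉; letI := θ.instVβ₁; letI := θ.instVβ₂; 0)) :=
  ⟨⟨fun Xh f => Ψ.Ψ Xh f - Ψ.Ψ Xh (fun _ => ((1 : MatA 2), (0 : MatA 2))), isLocal_subUnit _ Ψ.Ψ Ψ.isLocal, isGaugeInv_subUnit Ψ.Ψ Ψ.isGaugeInv⟩,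
    analyticOnUc_subUnit F Ψ.Ψ Mc k α₀ α₁ h.1, bound118OnUc_subUnit F Ψ.Ψ Mc k h₀ h₁ E₀ κ h.2.1, represents_subUnit F Ψ.Ψ a₀ ε₂₉ Mc k G h.2.2⟩

end Summit.QuantumFields.YangMills.Theorems.BalabanUVNodesPortS1

end
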